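import Literature.Geometry.Lorentzian.Genericity
import Literature.Geometry.Lorentzian.Hypersurface
import Mathlib.Topology.VectorBundle.Hom
import Mathlib.Analysis.Normed.Module.FiniteDimension
import HarnessLib

/-!
# Families of initial data sets from prescribed sections: algebra, positivity, assembly

Topic `Literature/Geometry/Lorentzian`. Plumbing for parameter-dependent deformations of initial data
sets on a FIXED manifold `X` whose new sections are AFFINE COMBINATIONS of the sections of given
families (the interpolation step of superposition constructions: a probe `G : ℝᵐ → data` and a
curve `γ : ℝ → data` through the same datum `d` are joined by the family with sections
`h_{G c} + θ (h_{γ t} − h_d)`, `k_{G c} + θ (k_{γ t} − k_d)`). Everything here is PROVED and there are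
no definitions. With `𝓥 x = T_xX →L T_xX →L ℝ` the bundle of bilinear forms on `TX`
(model fibre `E →L E →L ℝ`), whose total space carries the `C^∞` sections of an initial data set
(`InitialDataSet.contMDiff_k`, `IsSmoothDataFamily` of `Genericity.lean`):

* **Algebra** (`contMDiffAt_bilinSection_add/_smul/_neg/_sub` and the `ContMDiff` forms): for maps
  `m ↦ (b m, s m) ∈ 𝓥` from any manifold `M` which are `Cⁿ`, so are `m ↦ (b m, s m + t m)`,
  `m ↦ (b m, f m • s m)` (`f : M → ℝ` of class `Cⁿ`), … — read in the trivialisation at `b m₀`,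
  which is fibrewise linear (`Bundle.contMDiffAt_totalSpace`, `Trivialization.linear`); the
  parameter-free case is Mathlib's `ContMDiffAt.add_section` etc.
* **Positivity persists** (`eventually_posDef`, `eventually_forall_posDef_of_isCompact`,
  `exists_forall_posDef_of_isCompact`): if `m ↦ (b m, s m)` is continuous at `m₀` and `s m₀` is
  positive definite, then `s m` is positive definite for `m` near `m₀`; uniformly on a compact set of
  base points. Proof: frame the tangent spaces near `b m₀` by the tangent-bundle trivialisation,
  so that `(m, u) ↦ s m (e⁻¹u) (e⁻¹u)` is a continuous real function (`ContinuousAt.clm_bundle_apply₂`),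
  positive on `{m₀} × 𝕊` with `𝕊` the (compact) unit sphere of the model space, hence positive near
  `{m₀} × 𝕊` (`IsCompact.eventually_forall_of_forall_eventually`); homogeneity finishes.
* **Assembly** (`InitialDataSet.exists_family_of_sections`): jointly smooth families of sections
  `(h_q, k_q)_{q ∈ ℝᴺ}` which are symmetric with every `h_q` positive definite ARE the sections of a
  smooth `N`-parameter family of initial data sets (`IsSmoothDataFamily`), stated as an existence so
  that no definition is introduced.

Folklore differential topology (vector-bundle-valued maps read in trivialisations; openness of
positive definiteness); the context is Christodoulou's finite-dimensional families of initial data,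
CQG 16 (1999) A23–A35, p. A24.

## References

* D. Christodoulou, *On the global initial value problem and the issue of singularities*,
  Class. Quantum Grav. **16** (1999) A23–A35, p. A24. [Christodoulou1999]
-/

noncomputable section

-- instance search through nested operator types `E →L[ℝ] E →L[ℝ] ℝ` (as in `ChartCurvature`)
set_option maxSynthPendingDepth 3

open Bundle Set Filter Function
open scoped Manifold ContDiff Topology

namespace Literature.Geometry.Lorentzian

namespace InitialDataSet

variable {E : Type*} [NormedAddCommGroup E] [NormedSpace ℝ E] {H : Type*} [TopologicalSpace H]
  {I : ModelWithCorners ℝ E H} {X : Type*} [TopologicalSpace X] [ChartedSpace H X]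
  [IsManifold I ∞ X]

/-! ### Algebra of `Cⁿ` maps into the bundle of bilinear forms -/

section Algebra

variable {EM : Type*} [NormedAddCommGroup EM] [NormedSpace ℝ EM] {HM : Type*} [TopologicalSpace HM]
  {J : ModelWithCorners ℝ EM HM} {M : Type*} [TopologicalSpace M] [ChartedSpace HM M]
  {n : WithTop ℕ∞} {b : M → X}
  {s t : ∀ m : M, TangentSpace I (b m) →L[ℝ] TangentSpace I (b m) →L[ℝ] ℝ} {f : M → ℝ} {m₀ : M}

/-- **Sums of `Cⁿ` maps into the bundle of bilinear forms (over a common base map) are `Cⁿ`.**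
Read both maps in the trivialisation at `b m₀`, which is fibrewise linear. [folklore] -/
theorem contMDiffAt_bilinSection_add
    (hs : ContMDiffAt J (I.prod 𝓘(ℝ, E →L[ℝ] E →L[ℝ] ℝ)) n
      (fun m ↦ TotalSpace.mk' (E →L[ℝ] E →L[ℝ] ℝ)
        (E := fun x : X ↦ TangentSpace I x →L[ℝ] TangentSpace I x →L[ℝ] ℝ) (b m) (s m)) m₀)
    (ht : ContMDiffAt J (I.prod 𝓘(ℝ, E →L[ℝ] E →L[ℝ] ℝ)) n
      (fun m ↦ TotalSpace.mk' (E →L[ℝ] E →L[ℝ] ℝ)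
        (E := fun x : X ↦ TangentSpace I x →L[ℝ] TangentSpace I x →L[ℝ] ℝ) (b m) (t m)) m₀) :
    ContMDiffAt J (I.prod 𝓘(ℝ, E →L[ℝ] E →L[ℝ] ℝ)) n
      (fun m ↦ TotalSpace.mk' (E →L[ℝ] E →L[ℝ] ℝ)
        (E := fun x : X ↦ TangentSpace I x →L[ℝ] TangentSpace I x →L[ℝ] ℝ) (b m) (s m + t m)) m₀ := by
  rw [Bundle.contMDiffAt_totalSpace] at hs ht ⊢
  refine ⟨hs.1, ?_⟩
  have hev : ∀ᶠ m in 𝓝 m₀, b m ∈ (trivializationAt (E →L[ℝ] E →L[ℝ] ℝ)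
      (fun x : X ↦ TangentSpace I x →L[ℝ] TangentSpace I x →L[ℝ] ℝ) (b m₀)).baseSet :=
    hs.1.continuousAt.preimage_mem_nhds ((Trivialization.open_baseSet _).mem_nhds
      (FiberBundle.mem_baseSet_trivializationAt' (b m₀)))
  refine (hs.2.add ht.2).congr_of_eventuallyEq (hev.mono fun m hm ↦ ?_)
  exact ((trivializationAt (E →L[ℝ] E →L[ℝ] ℝ)
    (fun x : X ↦ TangentSpace I x →L[ℝ] TangentSpace I x →L[ℝ] ℝ) (b m₀)).linear ℝ hm).map_add
    (s m) (t m)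

/-- **Products of a `Cⁿ` real function with a `Cⁿ` map into the bundle of bilinear forms are
`Cⁿ`** (fibrewise linearity of the trivialisation at `b m₀`). [folklore] -/
theorem contMDiffAt_bilinSection_smul (hf : ContMDiffAt J 𝓘(ℝ) n f m₀)
    (hs : ContMDiffAt J (I.prod 𝓘(ℝ, E →L[ℝ] E →L[ℝ] ℝ)) n
      (fun m ↦ TotalSpace.mk' (E →L[ℝ] E →L[ℝ] ℝ)
        (E := fun x : X ↦ TangentSpace I x →L[ℝ] TangentSpace I x →L[ℝ] ℝ) (b m) (s m)) m₀) :
    ContMDiffAt J (I.prod 𝓘(ℝ, E →L[ℝ] E →L[ℝ] ℝ)) n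
      (fun m ↦ TotalSpace.mk' (E →L[ℝ] E →L[ℝ] ℝ)
        (E := fun x : X ↦ TangentSpace I x →L[ℝ] TangentSpace I x →L[ℝ] ℝ) (b m) (f m • s m)) m₀ := by
  rw [Bundle.contMDiffAt_totalSpace] at hs ⊢
  refine ⟨hs.1, ?_⟩
  have hev : ∀ᶠ m in 𝓝 m₀, b m ∈ (trivializationAt (E →L[ℝ] E →L[ℝ] ℝ)
      (fun x : X ↦ TangentSpace I x →L[ℝ] TangentSpace I x →L[ℝ] ℝ) (b m₀)).baseSet :=
    hs.1.continuousAt.preimage_mem_nhds ((Trivialization.open_baseSet _).mem_nhds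
      (FiberBundle.mem_baseSet_trivializationAt' (b m₀)))
  refine (hf.smul hs.2).congr_of_eventuallyEq (hev.mono fun m hm ↦ ?_)
  exact ((trivializationAt (E →L[ℝ] E →L[ℝ] ℝ)
    (fun x : X ↦ TangentSpace I x →L[ℝ] TangentSpace I x →L[ℝ] ℝ) (b m₀)).linear ℝ hm).map_smul
    (f m) (s m)

/-- **Negatives of `Cⁿ` maps into the bundle of bilinear forms are `Cⁿ`.** [folklore] -/
theorem contMDiffAt_bilinSection_neg
    (hs : ContMDiffAt J (I.prod 𝓘(ℝ, E →L[ℝ] E →L[ℝ] ℝ)) n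
      (fun m ↦ TotalSpace.mk' (E →L[ℝ] E →L[ℝ] ℝ)
        (E := fun x : X ↦ TangentSpace I x →L[ℝ] TangentSpace I x →L[ℝ] ℝ) (b m) (s m)) m₀) :
    ContMDiffAt J (I.prod 𝓘(ℝ, E →L[ℝ] E →L[ℝ] ℝ)) n
      (fun m ↦ TotalSpace.mk' (E →L[ℝ] E →L[ℝ] ℝ)
        (E := fun x : X ↦ TangentSpace I x →L[ℝ] TangentSpace I x →L[ℝ] ℝ) (b m) (-s m)) m₀ := by
  rw [Bundle.contMDiffAt_totalSpace] at hs ⊢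
  refine ⟨hs.1, ?_⟩
  have hev : ∀ᶠ m in 𝓝 m₀, b m ∈ (trivializationAt (E →L[ℝ] E →L[ℝ] ℝ)
      (fun x : X ↦ TangentSpace I x →L[ℝ] TangentSpace I x →L[ℝ] ℝ) (b m₀)).baseSet :=
    hs.1.continuousAt.preimage_mem_nhds ((Trivialization.open_baseSet _).mem_nhds
      (FiberBundle.mem_baseSet_trivializationAt' (b m₀)))
  refine hs.2.neg.congr_of_eventuallyEq (hev.mono fun m hm ↦ ?_)
  exact (((trivializationAt (E →L[ℝ] E →L[ℝ] ℝ)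
    (fun x : X ↦ TangentSpace I x →L[ℝ] TangentSpace I x →L[ℝ] ℝ) (b m₀)).linear ℝ hm).mk'
      _).map_neg (s m)

/-- **Differences of `Cⁿ` maps into the bundle of bilinear forms are `Cⁿ`.** [folklore] -/
theorem contMDiffAt_bilinSection_sub
    (hs : ContMDiffAt J (I.prod 𝓘(ℝ, E →L[ℝ] E →L[ℝ] ℝ)) n
      (fun m ↦ TotalSpace.mk' (E →L[ℝ] E →L[ℝ] ℝ)
        (E := fun x : X ↦ TangentSpace I x →L[ℝ] TangentSpace I x →L[ℝ] ℝ) (b m) (s m)) m₀)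
    (ht : ContMDiffAt J (I.prod 𝓘(ℝ, E →L[ℝ] E →L[ℝ] ℝ)) n
      (fun m ↦ TotalSpace.mk' (E →L[ℝ] E →L[ℝ] ℝ)
        (E := fun x : X ↦ TangentSpace I x →L[ℝ] TangentSpace I x →L[ℝ] ℝ) (b m) (t m)) m₀) :
    ContMDiffAt J (I.prod 𝓘(ℝ, E →L[ℝ] E →L[ℝ] ℝ)) n
      (fun m ↦ TotalSpace.mk' (E →L[ℝ] E →L[ℝ] ℝ)
        (E := fun x : X ↦ TangentSpace I x →L[ℝ] TangentSpace I x →L[ℝ] ℝ) (b m) (s m - t m)) m₀ := by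
  rw [Bundle.contMDiffAt_totalSpace] at hs ht ⊢
  refine ⟨hs.1, ?_⟩
  have hev : ∀ᶠ m in 𝓝 m₀, b m ∈ (trivializationAt (E →L[ℝ] E →L[ℝ] ℝ)
      (fun x : X ↦ TangentSpace I x →L[ℝ] TangentSpace I x →L[ℝ] ℝ) (b m₀)).baseSet :=
    hs.1.continuousAt.preimage_mem_nhds ((Trivialization.open_baseSet _).mem_nhds
      (FiberBundle.mem_baseSet_trivializationAt' (b m₀)))
  refine (hs.2.sub ht.2).congr_of_eventuallyEq (hev.mono fun m hm ↦ ?_)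
  exact (((trivializationAt (E →L[ℝ] E →L[ℝ] ℝ)
    (fun x : X ↦ TangentSpace I x →L[ℝ] TangentSpace I x →L[ℝ] ℝ) (b m₀)).linear ℝ hm).mk'
      _).map_sub (s m) (t m)

/-- `ContMDiff` form of `contMDiffAt_bilinSection_add`. [folklore] -/
theorem contMDiff_bilinSection_add
    (hs : ContMDiff J (I.prod 𝓘(ℝ, E →L[ℝ] E →L[ℝ] ℝ)) n
      (fun m ↦ TotalSpace.mk' (E →L[ℝ] E →L[ℝ] ℝ)
        (E := fun x : X ↦ TangentSpace I x →L[ℝ] TangentSpace I x →L[ℝ] ℝ) (b m) (s m)))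
    (ht : ContMDiff J (I.prod 𝓘(ℝ, E →L[ℝ] E →L[ℝ] ℝ)) n
      (fun m ↦ TotalSpace.mk' (E →L[ℝ] E →L[ℝ] ℝ)
        (E := fun x : X ↦ TangentSpace I x →L[ℝ] TangentSpace I x →L[ℝ] ℝ) (b m) (t m))) :
    ContMDiff J (I.prod 𝓘(ℝ, E →L[ℝ] E →L[ℝ] ℝ)) n
      (fun m ↦ TotalSpace.mk' (E →L[ℝ] E →L[ℝ] ℝ)
        (E := fun x : X ↦ TangentSpace I x →L[ℝ] TangentSpace I x →L[ℝ] ℝ) (b m) (s m + t m)) :=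
  fun m ↦ contMDiffAt_bilinSection_add (hs m) (ht m)

/-- `ContMDiff` form of `contMDiffAt_bilinSection_smul`. [folklore] -/
theorem contMDiff_bilinSection_smul (hf : ContMDiff J 𝓘(ℝ) n f)
    (hs : ContMDiff J (I.prod 𝓘(ℝ, E →L[ℝ] E →L[ℝ] ℝ)) n
      (fun m ↦ TotalSpace.mk' (E →L[ℝ] E →L[ℝ] ℝ)
        (E := fun x : X ↦ TangentSpace I x →L[ℝ] TangentSpace I x →L[ℝ] ℝ) (b m) (s m))) :
    ContMDiff J (I.prod 𝓘(ℝ, E →L[ℝ] E →L[ℝ] ℝ)) n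
      (fun m ↦ TotalSpace.mk' (E →L[ℝ] E →L[ℝ] ℝ)
        (E := fun x : X ↦ TangentSpace I x →L[ℝ] TangentSpace I x →L[ℝ] ℝ) (b m) (f m • s m)) :=
  fun m ↦ contMDiffAt_bilinSection_smul (hf m) (hs m)

/-- `ContMDiff` form of `contMDiffAt_bilinSection_sub`. [folklore] -/
theorem contMDiff_bilinSection_sub
    (hs : ContMDiff J (I.prod 𝓘(ℝ, E →L[ℝ] E →L[ℝ] ℝ)) n
      (fun m ↦ TotalSpace.mk' (E →L[ℝ] E →L[ℝ] ℝ)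
        (E := fun x : X ↦ TangentSpace I x →L[ℝ] TangentSpace I x →L[ℝ] ℝ) (b m) (s m)))
    (ht : ContMDiff J (I.prod 𝓘(ℝ, E →L[ℝ] E →L[ℝ] ℝ)) n
      (fun m ↦ TotalSpace.mk' (E →L[ℝ] E →L[ℝ] ℝ)
        (E := fun x : X ↦ TangentSpace I x →L[ℝ] TangentSpace I x →L[ℝ] ℝ) (b m) (t m))) :
    ContMDiff J (I.prod 𝓘(ℝ, E →L[ℝ] E →L[ℝ] ℝ)) n
      (fun m ↦ TotalSpace.mk' (E →L[ℝ] E →L[ℝ] ℝ)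
        (E := fun x : X ↦ TangentSpace I x →L[ℝ] TangentSpace I x →L[ℝ] ℝ) (b m) (s m - t m)) :=
  fun m ↦ contMDiffAt_bilinSection_sub (hs m) (ht m)

end Algebra

/-! ### Positive definiteness persists near a positive definite member -/

section PosDef

variable [FiniteDimensional ℝ E] {P : Type*} [TopologicalSpace P] {b : P → X}
  {s : ∀ p : P, TangentSpace I (b p) →L[ℝ] TangentSpace I (b p) →L[ℝ] ℝ} {p₀ : P}

/-- **Positive definiteness is an open condition along continuous maps into the bundle of bilinear
forms.** If `p ↦ (b p, s p)` is continuous at `p₀` and `s p₀` is positive definite on `T_{b p₀}X`,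
then `s p` is positive definite on `T_{b p}X` for all `p` near `p₀`. Proof: frame the tangent
spaces near `b p₀` by the tangent-bundle trivialisation `e`; `(p, u) ↦ s p (e⁻¹u) (e⁻¹u)` is
continuous and positive on `{p₀} × 𝕊` (`𝕊` the compact unit sphere of the model space), hence
positive near it; conclude by homogeneity. [folklore] -/
theorem eventually_posDef
    (hs : ContinuousAt (fun p ↦ TotalSpace.mk' (E →L[ℝ] E →L[ℝ] ℝ)
      (E := fun x : X ↦ TangentSpace I x →L[ℝ] TangentSpace I x →L[ℝ] ℝ) (b p) (s p)) p₀)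
    (h0 : ∀ v, v ≠ 0 → 0 < s p₀ v v) :
    ∀ᶠ p in 𝓝 p₀, ∀ v, v ≠ 0 → 0 < s p v v := by
  set e := trivializationAt E (TangentSpace I : X → Type _) (b p₀)
  have hb : ContinuousAt b p₀ := ((FiberBundle.continuousAt_totalSpace _ _).1 hs).1
  have hmem : b p₀ ∈ e.baseSet := FiberBundle.mem_baseSet_trivializationAt' (b p₀)
  -- the frame: `(p, u) ↦ e⁻¹_{b p} u` is continuous into `TX` near `{p₀} × E`
  have hV : ∀ u : E, ContinuousAt
      (fun z : P × E ↦ TotalSpace.mk' E (E := (TangentSpace I : X → Type _)) (b z.1)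
        (e.symm (b z.1) z.2)) (p₀, u) := by
    intro u
    have h1 : ContinuousAt (fun z : P × E ↦ ((b z.1, z.2) : X × E)) (p₀, u) :=
      (hb.comp continuousAt_fst).prodMk continuousAt_snd
    have h2 : ContinuousAt (fun y : X × E ↦ TotalSpace.mk' E (E := (TangentSpace I : X → Type _))
        y.1 (e.symm y.1 y.2)) (b p₀, u) :=
      e.continuousOn_symm.continuousAt
        ((e.open_baseSet.prod isOpen_univ).mem_nhds ⟨hmem, mem_univ _⟩)
    have h3 : ContinuousAt ((fun y : X × E ↦ TotalSpace.mk' E (E := (TangentSpace I : X → Type _))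
        y.1 (e.symm y.1 y.2)) ∘ (fun z : P × E ↦ ((b z.1, z.2) : X × E))) (p₀, u) :=
      ContinuousAt.comp_of_eq h2 h1 rfl
    exact h3
  -- the quadratic form along the frame is a continuous real function of `(p, u)`
  have hF : ∀ u : E, ContinuousAt
      (fun z : P × E ↦ s z.1 (e.symm (b z.1) z.2) (e.symm (b z.1) z.2)) (p₀, u) := by
    intro u
    have hψ : ContinuousAt (fun z : P × E ↦ TotalSpace.mk' (E →L[ℝ] E →L[ℝ] ℝ)
        (E := fun x : X ↦ TangentSpace I x →L[ℝ] TangentSpace I x →L[ℝ] ℝ) (b z.1) (s z.1))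
        (p₀, u) := by
      have h := ContinuousAt.comp_of_eq hs (continuousAt_fst (p := (p₀, u))) rfl
      exact h
    have h : ContinuousAt (fun z : P × E ↦ TotalSpace.mk' ℝ (E := Bundle.Trivial X ℝ) (b z.1)
        (s z.1 (e.symm (b z.1) z.2) (e.symm (b z.1) z.2))) (p₀, u) :=
      hψ.clm_bundle_apply₂ (F₁ := E) (F₂ := E) (hV u) (hV u)
    rw [FiberBundle.continuousAt_totalSpace] at h
    exact h.2
  -- positivity on `{p₀} × 𝕊`, hence near it
  have hS : IsCompact (Metric.sphere (0 : E) 1) := isCompact_sphere 0 1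
  have key : ∀ᶠ p in 𝓝 p₀, ∀ u ∈ Metric.sphere (0 : E) 1,
      0 < s p (e.symm (b p) u) (e.symm (b p) u) := by
    apply hS.eventually_forall_of_forall_eventually
    intro u hu
    have hu0 : u ≠ 0 := by
      rintro rfl
      simp at hu
    have hne : e.symm (b p₀) u ≠ 0 := by
      intro h
      apply hu0
      have h1 := e.apply_mk_symm hmem u
      rw [h] at h1
      have h2 := (e.linear ℝ hmem).map_zero
      rw [h1] at h2
      exact h2
    exact (hF u).eventually (eventually_gt_nhds (h0 _ hne))
  have hbase : ∀ᶠ p in 𝓝 p₀, b p ∈ e.baseSet := hb.preimage_mem_nhds (e.open_baseSet.mem_nhds hmem)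
  filter_upwards [key, hbase] with p hp hpb
  intro v hv
  -- coordinates `u` of `v`, normalised
  set u : E := (e ⟨b p, v⟩).2 with hu
  have huv : e.symm (b p) u = v := e.symm_apply_apply_mk hpb v
  have hu0 : u ≠ 0 := by
    intro h
    apply hv
    rw [← huv, h, ← e.symmL_apply (R := ℝ) hpb, map_zero]
  have hnorm : 0 < ‖u‖ := norm_pos_iff.2 hu0
  have hu₁ : ‖u‖⁻¹ • u ∈ Metric.sphere (0 : E) 1 := by
    rw [mem_sphere_zero_iff_norm, norm_smul, norm_inv, norm_norm, inv_mul_cancel₀ hnorm.ne']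
  have h1 := hp _ hu₁
  have hlin : e.symm (b p) (‖u‖⁻¹ • u) = ‖u‖⁻¹ • v := by
    rw [← e.symmL_apply (R := ℝ) hpb, map_smul, e.symmL_apply (R := ℝ) hpb, huv]
  rw [hlin, map_smul, map_smul, FunLike.coe_smul, Pi.smul_apply, smul_eq_mul,
    smul_eq_mul] at h1
  have hinv : 0 < ‖u‖⁻¹ := inv_pos.2 hnorm
  exact (mul_pos_iff_of_pos_left hinv).1 ((mul_pos_iff_of_pos_left hinv).1 h1)

variable {s' : P → ∀ x : X, TangentSpace I x →L[ℝ] TangentSpace I x →L[ℝ] ℝ}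

/-- **Positive definiteness persists uniformly on compact sets.** If `(p, x) ↦ (x, s p x)` is
continuous at every point of `{p₀} × X` and every `s p₀ x` is positive definite, then for `p` near
`p₀` the forms `s p x` are positive definite at every point `x` of a given compact set `K`
(`eventually_posDef` + `IsCompact.eventually_forall_of_forall_eventually`). [folklore] -/
theorem eventually_forall_posDef_of_isCompact
    (hs : ∀ x, ContinuousAt (fun z : P × X ↦ TotalSpace.mk' (E →L[ℝ] E →L[ℝ] ℝ)
      (E := fun x : X ↦ TangentSpace I x →L[ℝ] TangentSpace I x →L[ℝ] ℝ) z.2 (s' z.1 z.2)) (p₀, x))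
    (h0 : ∀ x v, v ≠ 0 → 0 < s' p₀ x v v) {K : Set X} (hK : IsCompact K) :
    ∀ᶠ p in 𝓝 p₀, ∀ x ∈ K, ∀ v, v ≠ 0 → 0 < s' p x v v :=
  hK.eventually_forall_of_forall_eventually fun x _ ↦
    eventually_posDef (b := fun z : P × X ↦ z.2) (s := fun z ↦ s' z.1 z.2) (hs x) (h0 x)

end PosDef

section PosDefNormed

variable [FiniteDimensional ℝ E] {P : Type*} [SeminormedAddCommGroup P]
  {s : P → ∀ x : X, TangentSpace I x →L[ℝ] TangentSpace I x →L[ℝ] ℝ}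

/-- **Positive definiteness persists uniformly on compact sets** (metric form, parameters in a
seminormed group, base parameter `0`): there is `ε > 0` such that `s p x` is positive definite for
all `‖p‖ < ε` and all `x` in the compact set `K`. [folklore] -/
theorem exists_forall_posDef_of_isCompact
    (hs : ∀ x, ContinuousAt (fun z : P × X ↦ TotalSpace.mk' (E →L[ℝ] E →L[ℝ] ℝ)
      (E := fun x : X ↦ TangentSpace I x →L[ℝ] TangentSpace I x →L[ℝ] ℝ) z.2 (s z.1 z.2)) (0, x))
    (h0 : ∀ x v, v ≠ 0 → 0 < s 0 x v v) {K : Set X} (hK : IsCompact K) :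
    ∃ ε : ℝ, 0 < ε ∧ ∀ p, ‖p‖ < ε → ∀ x ∈ K, ∀ v, v ≠ 0 → 0 < s p x v v := by
  obtain ⟨ε, hε, h⟩ := Metric.eventually_nhds_iff.1 (eventually_forall_posDef_of_isCompact hs h0 hK)
  exact ⟨ε, hε, fun p hp ↦ h (by simpa using hp)⟩

end PosDefNormed

/-! ### Smooth families of initial data sets with prescribed sections -/

section Assembly

variable [FiniteDimensional ℝ E] {N : ℕ}
  {hq kq : EuclideanSpace ℝ (Fin N) → ∀ x : X, TangentSpace I x →L[ℝ] TangentSpace I x →L[ℝ] ℝ}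

/-- **Smooth families of initial data sets with prescribed sections.** Jointly smooth families of
sections `(h_q, k_q)`, `q ∈ ℝᴺ`, of the bundle of bilinear forms on `TX`, symmetric and with every
`h_q` positive definite, are the sections of a smooth `N`-parameter family of initial data sets
(`IsSmoothDataFamily`): each member is an initial data set because its own sections are the
restrictions of the joint ones to `{q} × X`, and the unit balls of `h_q(x)` are bounded
(`isVonNBounded_setOf_lt_one_of_pos`, finite dimension). Stated as an existence (the family is
determined by its sections, `ext_of_sections` of `InitialDataPatch.lean`). [folklore] -/
theorem exists_family_of_sections
    (hh : ContMDiff (𝓘(ℝ, EuclideanSpace ℝ (Fin N)).prod I) (I.prod 𝓘(ℝ, E →L[ℝ] E →L[ℝ] ℝ)) ∞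
      (fun p : EuclideanSpace ℝ (Fin N) × X ↦ TotalSpace.mk' (E →L[ℝ] E →L[ℝ] ℝ)
        (E := fun x : X ↦ TangentSpace I x →L[ℝ] TangentSpace I x →L[ℝ] ℝ) p.2 (hq p.1 p.2)))
    (hk : ContMDiff (𝓘(ℝ, EuclideanSpace ℝ (Fin N)).prod I) (I.prod 𝓘(ℝ, E →L[ℝ] E →L[ℝ] ℝ)) ∞
      (fun p : EuclideanSpace ℝ (Fin N) × X ↦ TotalSpace.mk' (E →L[ℝ] E →L[ℝ] ℝ)
        (E := fun x : X ↦ TangentSpace I x →L[ℝ] TangentSpace I x →L[ℝ] ℝ) p.2 (kq p.1 p.2)))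
    (hsymm : ∀ q x v w, hq q x v w = hq q x w v) (hpos : ∀ q x v, v ≠ 0 → 0 < hq q x v v)
    (ksymm : ∀ q x v w, kq q x v w = kq q x w v) :
    ∃ P : EuclideanSpace ℝ (Fin N) → InitialDataSet I X,
      (∀ q, (P q).h.inner = hq q) ∧ (∀ q, (P q).k = kq q) ∧ IsSmoothDataFamily N P := by
  have hslice : ∀ q : EuclideanSpace ℝ (Fin N), ContMDiff I ((𝓘(ℝ, EuclideanSpace ℝ (Fin N))).prod I)
      ∞ (fun x : X ↦ ((q, x) : EuclideanSpace ℝ (Fin N) × X)) :=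
    fun q ↦ contMDiff_const.prodMk contMDiff_id
  refine ⟨fun q ↦
    { h :=
      { inner := hq q
        symm := hsymm q
        pos := hpos q
        isVonNBounded := fun x ↦
          PseudoRiemannianMetric.IsSpacelikeImmersion.isVonNBounded_setOf_lt_one_of_pos (V := E)
            (show E →L[ℝ] E →L[ℝ] ℝ from hq q x) (hpos q x)
        contMDiff := hh.comp (hslice q) }
      k := kq q
      k_symm := ksymm q
      contMDiff_k := hk.comp (hslice q) }, fun _ ↦ rfl, fun _ ↦ rfl, hh, hk⟩

end Assembly

end InitialDataSet

end Literature.Geometry.Lorentzian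

end
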